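import Literature.NumberTheory.LFunctions.Zhang2022.Section7TailP2Aux
import Literature.NumberTheory.LFunctions.Zhang2022.Section5Lemma53
import Literature.NumberTheory.LFunctions.Zhang2022.TypedSection13Edges
import HarnessLib

/-!
# Zhang (2022) §7, proof of Proposition 7.1 (b): the tail `l > P²` of `𝔰(r,h,d;θ)` is negligible

Cell `siegel-zhang` (D-0069 width campaign), layer L2, DAG node `Z22:(7.14)` lead-in prose
[Z22 p.38, tex L2008]: "By Lemma 5.3, for `dhr < P₁`, the terms in `𝔰(r,h,d;θ)` with `l > P²` make a
negligible error", typed by L2-t4 as `Section7cStatements.Step7bTruncP2 c′` (the tail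
`Section7cStatements.tail7P2` is `≤ exp(−c𝓛¹⁰)` for `(d,h,r) ∈ tripleSet D`, `θ` primitive, `𝐚₁`
admissible (7.2)) — the one hypothesis left open by L2-t4's edge `step7u034_of`. Y. Zhang,
arXiv:2211.02515v1 [Zhang2022LandauSiegel], an unrefereed manuscript under adjudication; nothing here
concerns its Theorems 1–2. This file DISCHARGES the node: `step7bTruncP2_holds : ∀ c′, Step7bTruncP2 c′`
(with `c = 1/2`; the primitivity of `θ` and hypothesis (A) are not used).

Route (all inputs are tree theorems): `|(κ∗𝐚₁)(dl)| ≤ B·Σ_{k∣dl}|κ(k)| ≤ B·τ(dl)⁴ ≤ B·C_τ⁴(dl)^{1/4}`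
(`MeanSquareMajorant.norm_conv_le`, `XiZeroMajorants.norm_kappa_le_card_divisors_pow`, the divisor
bound `Sieve.exists_card_divisors_le_mul_rpow`); `|θ(l)|, |θ̄(p)|, |p^{β₃}| ≤ 1`; for `l > P²`,
`p ∼ P` (`p ≤ 2P`), `hr < P₁ = P^{0.504}` the argument `y = l/(phr)` exceeds `P^{0.496}/2 ≥ e^{0.49𝓛⁹}
> t₀^{1.02}`, and there Lemma 5.3 (ii) (`Skeleton.lemma53_holds`) gives
`|Δ(y)| ≤ C(e^{−(𝓛₂log y/100)²} + e^{−y^{0.99}/𝓛₂}) ≤ 2C·e^{−𝓛¹⁰}·P⁻⁸·y⁻⁴` (`norm_DeltaW_le_far`);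
summing over the `≤ 3P` primes of the window and over `l` (`Σ_l l^{1/2−4} < ∞`) leaves
`≤ K·e^{−𝓛¹⁰} ≤ e^{−𝓛¹⁰/2}` for `D` large. [cite: Zhang2022LandauSiegel, §7 p.38 (proof of Prop. 7.1)]
-/

noncomputable section

open Complex Real Finset

namespace Literature.NumberTheory.LFunctions.Zhang2022.Section7TailP2

open Literature.NumberTheory.LFunctions.Zhang2022.Skeleton
open Literature.NumberTheory.LFunctions.Zhang2022.Section7cStatements

/-! ### The tail `l > P²`: one term -/

/-- **One term of the tail.** For `𝓛 ≥ 3`, `|𝐚₁| ≤ B`, the divisor bound `τ(n) ≤ C₁n^{1/16}`, the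
Lemma-5.3 (ii) clause with constant `C ≥ 0`, and `d, h, r ≥ 1` with `hr ≤ P₁`, `d ≤ P₁`:
`‖[l > P², (l,h)=1]·(κ∗𝐚₁)(dl)θ(l)Σ_{p∼P}p^{β₃}θ̄(p)Δ(l/(phr))‖ ≤ M·l^{−7/2}` with
`M = B·C₁⁴·#{p∼P}·2C·e^{−𝓛¹⁰}e^{−8𝓛⁹}·(2P·P₁)⁴`.
[cite: Zhang2022LandauSiegel, §7 p.38 (proof of Prop. 7.1)] -/
theorem norm_tailTerm_le (c' : ℝ) {D : ℕ} (hℓ3 : 3 ≤ ell D) {a₁ : ℕ → ℂ} {B : ℝ}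
    (ha : ∀ n, ‖a₁ n‖ ≤ B) {C₁ : ℝ} (hC₁0 : 0 ≤ C₁)
    (hτ : ∀ n : ℕ, n ≠ 0 → (n.divisors.card : ℝ) ≤ C₁ * (n : ℝ) ^ (1 / 16 : ℝ)) {C : ℝ}
    (hC0 : 0 ≤ C)
    (h53D : ∀ x : ℝ, 0 < x → t0 D ^ (1.02 : ℝ) < x →
      ‖DeltaW D x‖ ≤ C * (Real.exp (-((1 : ℝ) / 100 * ell2 D * Real.log x) ^ 2) +
        Real.exp (-(x ^ (0.99 : ℝ)) / ell2 D)))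
    {d h r : ℕ} (hd1 : 1 ≤ d) (hh1 : 1 ≤ h) (hr1 : 1 ≤ r) (hhr : (h : ℝ) * r ≤ Skeleton.P1 D)
    (hdle : (d : ℝ) ≤ Skeleton.P1 D) (θ : DirichletCharacter ℂ r) (l : ℕ) :
    ‖(if bigP D ^ 2 < (l : ℝ) ∧ Nat.Coprime l h then
        MeanSquareMajorant.conv (kappaZ c' D) a₁ (d * l) * θ (l : ZMod r) *
          ∑ p ∈ primeWindow D, (p : ℂ) ^ beta3 c' D * θ⁻¹ (p : ZMod r) *
            DeltaW D ((l : ℝ) / ((p : ℝ) * h * r))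
      else 0)‖ ≤
      (B * C₁ ^ 4 * (((primeWindow D).card : ℝ) *
        (2 * C * (Real.exp (-(ell D ^ 10)) * Real.exp (-(8 * ell D ^ 9))) *
          (2 * bigP D * Skeleton.P1 D) ^ 4))) * (l : ℝ) ^ (-(7 / 2 : ℝ)) := by
  have hℓ0 : 0 < ell D := by linarith
  have hℓ1 : 1 ≤ ell D := by linarith
  have hB0 : 0 ≤ B := le_trans (norm_nonneg _) (ha 0)
  have hh0 : (0 : ℝ) < h := by exact_mod_cast hh1
  have hr0 : (0 : ℝ) < r := by exact_mod_cast hr1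
  have hPpos : 0 < bigP D := Real.exp_pos _
  have hP1pos : 0 < Skeleton.P1 D := Real.rpow_pos_of_pos hPpos _
  have hPone : 1 ≤ bigP D := Real.one_le_exp (by positivity)
  -- `P₁ ≤ P²`, `P² = P · P₁ · P^{0.496}`
  have hP1sq : Skeleton.P1 D ≤ bigP D ^ 2 := by
    rw [Skeleton.P1, ← Real.rpow_two]
    exact Real.rpow_le_rpow_of_exponent_le hPone (by norm_num)
  have hPsplit : bigP D ^ 2 = bigP D * Skeleton.P1 D * bigP D ^ (0.496 : ℝ) := by
    rw [Skeleton.P1, ← Real.rpow_two, show (2 : ℝ) = 1 + 0.504 + 0.496 by norm_num,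
      Real.rpow_add hPpos, Real.rpow_add hPpos, Real.rpow_one]
  have hy₀ := (exp_049_le_and_t0_lt hℓ3).1
  set E : ℝ := Real.exp (-(ell D ^ 10)) * Real.exp (-(8 * ell D ^ 9)) with hE
  set Q : ℝ := (2 * bigP D * Skeleton.P1 D) ^ 4 with hQ
  set M : ℝ := B * C₁ ^ 4 * (((primeWindow D).card : ℝ) * (2 * C * E * Q)) with hM
  have hE0 : 0 < E := by positivity
  have hQ0 : 0 < Q := by positivity
  have hM0 : 0 ≤ M := by positivity
  by_cases hl : bigP D ^ 2 < (l : ℝ) ∧ Nat.Coprime l h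
  swap
  · rw [if_neg hl, norm_zero]; positivity
  rw [if_pos hl]
  obtain ⟨hlP, -⟩ := hl
  have hl0 : (0 : ℝ) < l := lt_of_le_of_lt (by positivity) hlP
  have hln : l ≠ 0 := by exact_mod_cast hl0.ne'
  -- (i) the convolution factor
  have hconv : ‖MeanSquareMajorant.conv (kappaZ c' D) a₁ (d * l)‖ ≤
      B * C₁ ^ 4 * (l : ℝ) ^ (1 / 2 : ℝ) := by
    have hdl0 : d * l ≠ 0 := Nat.mul_ne_zero (by omega) hln
    refine (norm_conv_kappa_le c' D ha (d * l)).trans ?_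
    have h1 : ((d * l).divisors.card : ℝ) ≤ C₁ * ((d * l : ℕ) : ℝ) ^ (1 / 16 : ℝ) := hτ _ hdl0
    have h2 : ((d * l : ℕ) : ℝ) ^ (1 / 16 : ℝ) ≤ ((l : ℝ) ^ 2) ^ (1 / 16 : ℝ) := by
      apply Real.rpow_le_rpow (by positivity) _ (by norm_num)
      push_cast
      have : (d : ℝ) ≤ l := by linarith [hP1sq]
      nlinarith
    have h3 : ((l : ℝ) ^ 2) ^ (1 / 16 : ℝ) = (l : ℝ) ^ (1 / 8 : ℝ) := by
      rw [← Real.rpow_natCast, ← Real.rpow_mul hl0.le]; norm_num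
    have h4 : ((d * l).divisors.card : ℝ) ≤ C₁ * (l : ℝ) ^ (1 / 8 : ℝ) :=
      h1.trans (mul_le_mul_of_nonneg_left (h2.trans_eq h3) hC₁0)
    have h5 : ((d * l).divisors.card : ℝ) ^ 4 ≤ (C₁ * (l : ℝ) ^ (1 / 8 : ℝ)) ^ 4 :=
      pow_le_pow_left₀ (by positivity) h4 4
    have h6 : (C₁ * (l : ℝ) ^ (1 / 8 : ℝ)) ^ 4 = C₁ ^ 4 * (l : ℝ) ^ (1 / 2 : ℝ) := by
      rw [mul_pow, ← Real.rpow_natCast ((l : ℝ) ^ (1 / 8 : ℝ)), ← Real.rpow_mul hl0.le]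
      norm_num
    calc B * ((d * l).divisors.card : ℝ) ^ 4 ≤ B * (C₁ * (l : ℝ) ^ (1 / 8 : ℝ)) ^ 4 :=
          mul_le_mul_of_nonneg_left h5 hB0
      _ = B * C₁ ^ 4 * (l : ℝ) ^ (1 / 2 : ℝ) := by rw [h6]; ring
  -- (ii) the character
  have hθl : ‖θ (l : ZMod r)‖ ≤ 1 := θ.norm_le_one _
  -- (iii) the prime sum
  have hΔ : ∀ p ∈ primeWindow D,
      ‖(p : ℂ) ^ beta3 c' D * θ⁻¹ (p : ZMod r) * DeltaW D ((l : ℝ) / ((p : ℝ) * h * r))‖ ≤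
        2 * C * E * Q * ((l : ℝ) ^ 4)⁻¹ := by
    intro p hpw
    have hpr := prime_of_mem_primeWindow' hpw
    have hp0 : (0 : ℝ) < p := by exact_mod_cast hpr.pos
    have hp2 : (p : ℝ) ≤ 2 * bigP D := le_two_mul_bigP_of_mem_primeWindow hℓ1 hpw
    have hphr0 : 0 < (p : ℝ) * h * r := by positivity
    have hphr : (p : ℝ) * h * r ≤ 2 * bigP D * Skeleton.P1 D := by
      calc (p : ℝ) * h * r = p * (h * r) := by ring
        _ ≤ 2 * bigP D * Skeleton.P1 D := mul_le_mul hp2 hhr (by positivity) (by positivity)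
    set y : ℝ := (l : ℝ) / ((p : ℝ) * h * r) with hy
    have hylow : Real.exp (0.49 * ell D ^ 9) ≤ y := by
      refine hy₀.trans ?_
      rw [hy, le_div_iff₀ hphr0]
      have h1 : bigP D ^ (0.496 : ℝ) / 2 * ((p : ℝ) * h * r) ≤
          bigP D ^ (0.496 : ℝ) / 2 * (2 * bigP D * Skeleton.P1 D) :=
        mul_le_mul_of_nonneg_left hphr (by positivity)
      refine h1.trans ?_
      calc bigP D ^ (0.496 : ℝ) / 2 * (2 * bigP D * Skeleton.P1 D) = bigP D ^ 2 := by
            rw [hPsplit]; ring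
        _ ≤ l := hlP.le
    have hΔy := norm_DeltaW_le_far hℓ3 hC0 h53D hylow
    have hβ : ‖(p : ℂ) ^ beta3 c' D‖ = 1 := by
      rw [Complex.norm_natCast_cpow_of_pos hpr.pos, Typed.Section13.beta3_re, Real.rpow_zero]
    have hθp : ‖θ⁻¹ (p : ZMod r)‖ ≤ 1 := θ⁻¹.norm_le_one _
    have hy4 : (y ^ 4)⁻¹ ≤ Q * ((l : ℝ) ^ 4)⁻¹ := by
      rw [hy, div_pow, inv_div, hQ, div_eq_mul_inv]
      exact mul_le_mul_of_nonneg_right (pow_le_pow_left₀ hphr0.le hphr 4) (by positivity)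
    rw [norm_mul, norm_mul, hβ, one_mul]
    calc ‖θ⁻¹ (p : ZMod r)‖ * ‖DeltaW D y‖ ≤ 1 * ‖DeltaW D y‖ :=
          mul_le_mul_of_nonneg_right hθp (norm_nonneg _)
      _ ≤ 2 * C * (Real.exp (-(ell D ^ 10)) * Real.exp (-(8 * ell D ^ 9)) * (y ^ 4)⁻¹) := by
          rw [one_mul]; exact hΔy
      _ = 2 * C * E * (y ^ 4)⁻¹ := by rw [hE]; ring
      _ ≤ 2 * C * E * (Q * ((l : ℝ) ^ 4)⁻¹) := mul_le_mul_of_nonneg_left hy4 (by positivity)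
      _ = 2 * C * E * Q * ((l : ℝ) ^ 4)⁻¹ := by ring
  have hsum : ‖∑ p ∈ primeWindow D, (p : ℂ) ^ beta3 c' D * θ⁻¹ (p : ZMod r) *
      DeltaW D ((l : ℝ) / ((p : ℝ) * h * r))‖ ≤
      ((primeWindow D).card : ℝ) * (2 * C * E * Q * ((l : ℝ) ^ 4)⁻¹) := by
    refine (norm_sum_le _ _).trans ?_
    have := Finset.sum_le_card_nsmul _ _ _ hΔ
    rwa [nsmul_eq_mul] at this
  -- combine
  have hl72 : (l : ℝ) ^ (1 / 2 : ℝ) * ((l : ℝ) ^ 4)⁻¹ = (l : ℝ) ^ (-(7 / 2 : ℝ)) := by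
    rw [← Real.rpow_natCast (l : ℝ) 4, ← Real.rpow_neg hl0.le, ← Real.rpow_add hl0]
    norm_num
  rw [norm_mul, norm_mul]
  calc ‖MeanSquareMajorant.conv (kappaZ c' D) a₁ (d * l)‖ * ‖θ (l : ZMod r)‖ *
        ‖∑ p ∈ primeWindow D, (p : ℂ) ^ beta3 c' D * θ⁻¹ (p : ZMod r) *
          DeltaW D ((l : ℝ) / ((p : ℝ) * h * r))‖
      ≤ (B * C₁ ^ 4 * (l : ℝ) ^ (1 / 2 : ℝ)) * 1 *
          (((primeWindow D).card : ℝ) * (2 * C * E * Q * ((l : ℝ) ^ 4)⁻¹)) := by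
        apply mul_le_mul (mul_le_mul hconv hθl (norm_nonneg _) (by positivity)) hsum
          (norm_nonneg _) (by positivity)
    _ = M * ((l : ℝ) ^ (1 / 2 : ℝ) * ((l : ℝ) ^ 4)⁻¹) := by rw [hM]; ring
    _ = M * (l : ℝ) ^ (-(7 / 2 : ℝ)) := by rw [hl72]

/-- **The constants.** `#{p∼P}·e^{−8𝓛⁹}·(2P·P₁)⁴ ≤ 48` (`#{p∼P} ≤ 3P`, `P₁⁴ = P^{2.016}`,
`3·16·P^{1+4+2.016−8} ≤ 48`), for `𝓛 ≥ 1`. [cite: Zhang2022LandauSiegel, §2 (2.6), (2.21)] -/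
theorem card_mul_window_const_le {D : ℕ} (hℓ1 : 1 ≤ ell D) :
    ((primeWindow D).card : ℝ) * (Real.exp (-(8 * ell D ^ 9)) * (2 * bigP D * Skeleton.P1 D) ^ 4)
      ≤ 48 := by
  have hP14 : Skeleton.P1 D ^ 4 = Real.exp (2.016 * ell D ^ 9) := by
    rw [Skeleton.P1, bigP, ← Real.exp_mul, ← Real.exp_nat_mul]; ring_nf
  have hcard := card_primeWindow_le (D := D) hℓ1
  have hmul : ∀ a b : ℝ, Real.exp a * Real.exp b = Real.exp (a + b) :=
    fun a b => (Real.exp_add a b).symm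
  have hprod : 3 * bigP D * (Real.exp (-(8 * ell D ^ 9)) * (2 * bigP D * Skeleton.P1 D) ^ 4) =
      48 * Real.exp (-(0.984 * ell D ^ 9)) := by
    rw [mul_pow, mul_pow, hP14, bigP, ← Real.exp_nat_mul]
    calc 3 * Real.exp (ell D ^ 9) * (Real.exp (-(8 * ell D ^ 9)) *
          ((2 : ℝ) ^ 4 * Real.exp ((4 : ℕ) * ell D ^ 9) * Real.exp (2.016 * ell D ^ 9)))
        = 48 * (Real.exp (ell D ^ 9) * Real.exp (-(8 * ell D ^ 9)) *
            Real.exp ((4 : ℕ) * ell D ^ 9) * Real.exp (2.016 * ell D ^ 9)) := by norm_num; ring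
      _ = 48 * Real.exp (-(0.984 * ell D ^ 9)) := by rw [hmul, hmul, hmul]; push_cast; ring_nf
  have hle1 : Real.exp (-(0.984 * ell D ^ 9)) ≤ 1 := by
    rw [Real.exp_le_one_iff]
    have h0 : 0 ≤ ell D ^ 9 := by positivity
    linarith
  calc _ ≤ 3 * bigP D * (Real.exp (-(8 * ell D ^ 9)) * (2 * bigP D * Skeleton.P1 D) ^ 4) :=
        mul_le_mul_of_nonneg_right hcard (by positivity)
    _ = 48 * Real.exp (-(0.984 * ell D ^ 9)) := hprod
    _ ≤ 48 * 1 := mul_le_mul_of_nonneg_left hle1 (by norm_num)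
    _ = 48 := by norm_num

/-! ### The tail `l > P²`: the node -/

/-- **`Z22:(7.14)` lead-in DISCHARGED** [Z22 p.38, tex L2008]: L2-t4's `Step7bTruncP2 c′` holds for
every `c′`, with `c = 1/2`: for `D` large (depending on the (7.2)-bound `B` of `𝐚₁`), every
admissible `𝐚₁`, every `(d,h,r) ∈ tripleSet D` and every character `θ (mod r)`,
`‖Σ_{l>P²,(l,h)=1}(κ∗𝐚₁)(dl)θ(l)Σ_{p∼P}p^{β₃}θ̄(p)Δ(l/(phr))‖ ≤ e^{−𝓛¹⁰/2}`.
[cite: Zhang2022LandauSiegel, §7 p.38 (proof of Prop. 7.1, "By Lemma 5.3 … negligible")] -/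
theorem step7bTruncP2_holds (c' : ℝ) : Step7bTruncP2 c' := by
  intro B
  obtain ⟨c53, -, C53, D53, h53⟩ := lemma53_holds
  obtain ⟨C₁, hC₁, hτ⟩ := Literature.NumberTheory.Sieve.exists_card_divisors_le_mul_rpow
    (show (0 : ℝ) < 1 / 16 by norm_num)
  have hC₁0 : 0 ≤ C₁ := zero_le_one.trans hC₁
  set C : ℝ := max C53 0 with hCdef
  have hC0 : 0 ≤ C := le_max_right _ _
  have hZsum : Summable fun l : ℕ => (l : ℝ) ^ (-(7 / 2 : ℝ)) :=
    Real.summable_nat_rpow.2 (by norm_num)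
  set Z : ℝ := ∑' l : ℕ, (l : ℝ) ^ (-(7 / 2 : ℝ)) with hZ
  have hZ0 : 0 ≤ Z := tsum_nonneg fun l => by positivity
  set K : ℝ := |B| * C₁ ^ 4 * (2 * C * Z) * 48 with hK
  have hK0 : 0 ≤ K := by positivity
  refine ⟨1 / 2, by norm_num, max D53 ⌈Real.exp (2 * Real.log (K + 1) + 3)⌉₊,
    fun D _ χ hD hq hp _ a₁ ha₁ d h r θ hmem _ => ?_⟩
  -- `D` is large
  have hD53 : D53 ≤ D := le_trans (le_max_left _ _) hD
  have hℓK : 2 * Real.log (K + 1) + 3 ≤ ell D := by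
    have hexp : Real.exp (2 * Real.log (K + 1) + 3) ≤ D :=
      le_trans (Nat.le_ceil _) (by exact_mod_cast le_trans (le_max_right _ _) hD)
    exact (Real.le_log_iff_exp_le (lt_of_lt_of_le (Real.exp_pos _) hexp)).mpr hexp
  have hlogK : 0 ≤ Real.log (K + 1) := Real.log_nonneg (by linarith)
  have hℓ3 : 3 ≤ ell D := by linarith
  have hℓ1 : 1 ≤ ell D := by linarith
  -- the data
  have ha : ∀ n, ‖a₁ n‖ ≤ B := ha₁.1
  have hB0 : 0 ≤ B := le_trans (norm_nonneg _) (ha 0)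
  have hBabs : |B| = B := abs_of_nonneg hB0
  simp only [tripleSet, Finset.mem_filter, Finset.mem_product, Finset.mem_Ico] at hmem
  obtain ⟨⟨⟨hd1, -⟩, ⟨hh1, -⟩, ⟨hr2, -⟩⟩, hdhr⟩ := hmem
  have hr1 : 1 ≤ r := by omega
  have hh0 : (0 : ℝ) < h := by exact_mod_cast hh1
  have hr0 : (0 : ℝ) < r := by exact_mod_cast hr1
  have hdhr' : (d : ℝ) * h * r < Skeleton.P1 D := by exact_mod_cast hdhr
  have hhr : (h : ℝ) * r ≤ Skeleton.P1 D := by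
    have h1 : (1 : ℝ) ≤ d := by exact_mod_cast hd1
    nlinarith [mul_pos hh0 hr0]
  have hdle : (d : ℝ) ≤ Skeleton.P1 D := by
    have h1 : (1 : ℝ) ≤ h := by exact_mod_cast hh1
    have h2 : (1 : ℝ) ≤ r := by exact_mod_cast hr1
    have hd0 : (0 : ℝ) ≤ d := by positivity
    nlinarith [mul_le_mul h1 h2 zero_le_one (by positivity : (0:ℝ) ≤ h)]
  -- Lemma 5.3 (ii) at `D`
  have h53D : ∀ x : ℝ, 0 < x → t0 D ^ (1.02 : ℝ) < x →
      ‖DeltaW D x‖ ≤ C * (Real.exp (-((1 : ℝ) / 100 * ell2 D * Real.log x) ^ 2) +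
        Real.exp (-(x ^ (0.99 : ℝ)) / ell2 D)) := fun x hx hx' =>
    ((h53 D χ hD53 hq hp x hx).2 hx').trans (mul_le_mul_of_nonneg_right (le_max_left _ _)
      (by positivity))
  -- termwise bound and summation
  set M : ℝ := B * C₁ ^ 4 * (((primeWindow D).card : ℝ) *
    (2 * C * (Real.exp (-(ell D ^ 10)) * Real.exp (-(8 * ell D ^ 9))) *
      (2 * bigP D * Skeleton.P1 D) ^ 4)) with hM
  have hbound := fun l => norm_tailTerm_le c' hℓ3 ha hC₁0 hτ hC0 h53D hd1 hh1 hr1 hhr hdle θ l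
  have hsumT : Summable fun l : ℕ => ‖(if bigP D ^ 2 < (l : ℝ) ∧ Nat.Coprime l h then
        MeanSquareMajorant.conv (kappaZ c' D) a₁ (d * l) * θ (l : ZMod r) *
          ∑ p ∈ primeWindow D, (p : ℂ) ^ beta3 c' D * θ⁻¹ (p : ZMod r) *
            DeltaW D ((l : ℝ) / ((p : ℝ) * h * r))
      else 0)‖ :=
    Summable.of_nonneg_of_le (fun l => norm_nonneg _) hbound (hZsum.mul_left M)
  have htot : ‖tail7P2 c' D a₁ r h d θ‖ ≤ M * Z := by
    rw [tail7P2]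
    refine (norm_tsum_le_tsum_norm hsumT).trans ?_
    calc _ ≤ ∑' l : ℕ, M * (l : ℝ) ^ (-(7 / 2 : ℝ)) := hsumT.tsum_le_tsum hbound (hZsum.mul_left M)
      _ = M * Z := by rw [tsum_mul_left]
  refine htot.trans ?_
  -- `M·Z ≤ K e^{−𝓛¹⁰} ≤ e^{−𝓛¹⁰/2}`
  have hconst := card_mul_window_const_le (D := D) hℓ1
  have hMZ : M * Z ≤ K * Real.exp (-(ell D ^ 10)) := by
    have e1 : M * Z = B * C₁ ^ 4 * (2 * C * Z) * Real.exp (-(ell D ^ 10)) *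
        (((primeWindow D).card : ℝ) * (Real.exp (-(8 * ell D ^ 9)) *
          (2 * bigP D * Skeleton.P1 D) ^ 4)) := by rw [hM]; ring
    rw [e1, hK, hBabs]
    have hpre : 0 ≤ B * C₁ ^ 4 * (2 * C * Z) * Real.exp (-(ell D ^ 10)) := by positivity
    calc _ ≤ B * C₁ ^ 4 * (2 * C * Z) * Real.exp (-(ell D ^ 10)) * 48 :=
          mul_le_mul_of_nonneg_left hconst hpre
      _ = B * C₁ ^ 4 * (2 * C * Z) * 48 * Real.exp (-(ell D ^ 10)) := by ring
  refine hMZ.trans ?_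
  have hℓ10 : ell D ≤ ell D ^ 10 := by
    calc ell D = ell D ^ 1 := (pow_one _).symm
      _ ≤ ell D ^ 10 := pow_le_pow_right₀ hℓ1 (by norm_num)
  have hKexp : K ≤ Real.exp (ell D ^ 10 / 2) := by
    have h2 : K + 1 = Real.exp (Real.log (K + 1)) := (Real.exp_log (by linarith)).symm
    have h3 : Real.log (K + 1) ≤ ell D ^ 10 / 2 := by linarith
    linarith [Real.exp_le_exp.mpr h3]
  have hsplit : Real.exp (-(1 / 2) * ell D ^ 10) =
      Real.exp (ell D ^ 10 / 2) * Real.exp (-(ell D ^ 10)) := by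
    rw [← Real.exp_add]; ring_nf
  rw [hsplit]
  exact mul_le_mul_of_nonneg_right hKexp (Real.exp_pos _).le

end Literature.NumberTheory.LFunctions.Zhang2022.Section7TailP2
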